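import Summits.ResolutionOfSingularities.ResolutionOfSingularities.Theorems.EquisingularLiftEquisingularLiftNatPrefixSupplierDefs
import Summits.ResolutionOfSingularities.ResolutionOfSingularities.Theorems.EquisingularLiftEquisingularLiftNatResidueHypDefs11
import HarnessLib

/-!
# [OURS · L1 W4.5(b) · EL♮(3) · WIDTH TABLE W₂ «Σ-SECTION ROUND», engine row] K5⁹ — THE LETTERED-PREFIX T-ISO ENGINE WITH Σ-SECTION HOSTED ROUNDS AND RAMIFIED PREFIX POINTS
# `target_elnat_of_letteredPrefixResolution9` = ✓ K5⁸ `target_elnat_of_letteredPrefixResolution8` (res-type-027 g22) over the W₂ block `PrefixReachKeyLetterParam9`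
# (res-type-027 g23, `…NatResidueHypDefs11`), suppliers BY NAMED SLOT (`…NatPrefixSupplierDefs`), TWO new slots HROUND-SEC / HPRAM

res-L1-w45b-stub-4 g15 (desk RULING R73 (ii) / R73a (ii): default owner of the W₂ ISO engine; design line l.86393 option (B) «named supplier slots»).
WHAT CHANGED vs ✓ K5⁸ (everything else VERBATIM — upstairs invariant, base model square, the eight K5⁸ closure cases, END transport): (1) the six supplier
binders are the NAMED slots `HSub1Supplier k n Reach` · `HSub2Supplier k n H ι ReachL LS` · `HPT6Supplier k n` · `HOpenSupplier k n H ι Open` · `HPairSupplier k n`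
· `HRoundKeepNSupplier k n` (each = K5⁸'s binder text byte for byte, `δ`-unfolded at use); (2) the last hypothesis is `∃ F' ρ' T', PrefixReachKeyLetterParam9 … ∧ (end
regular)` — Defs10's P8 block + the TWO PREFIX CLAUSES of WIDTH TABLE W₂: (HR-SEC) the Σ-SECTION hosted round in a listed host ((N2) «host regular along `Z̃`» ↦ (L2)
«`𝓘⟨Z⟩ = 𝓘⟨Ẽ₁⟩ + (f)`, `f` a parameter, at every closed point of `Z`», (N4) deleted) and (P-ram) the HOSTLESS RAMIFIED POINT STEP (blow up `J` supported at a closed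
non-regular point of `T̃₁`, `J` generated by three cotangent-independent elements; letters and tag dropped); (3) TWO new supplier slots and their induction cases:
HROUND-SEC (`HRoundSecSupplier k n`; case = the (HR-KEEP-N) case verbatim) and HPRAM (`HPRamSupplier k n`; case = new model square, letters `[]`, tag `none`).  At
`n = 3` the suppliers are the tree's (RUNG⁸'s five + `NodalHostedRoundFact`'s), HPRAM := ✓ `fatPointStep_model` repackaged (`TCPlus.hpram_supplier`, this seat), and
HROUND-SEC := ✓ `embeddedLiftFact_holds` + res-L1-w45b-nose-w1's (u2) (composition owed, R73a (ii)).  PURE LOGIC AROUND IT (Defs11): `PrefixReachKeyLetterParam8 → …9`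
(two ADDED clauses), so RUNG⁹ over `IsoHypReachNDLeavesP9` re-derives RUNG⁸'s class and the certified customer Q47₂ (lead-1) — nothing of EL♮(3) is proved by this.
OURS; NOT a statement of any manuscript ([Hironaka2017] is a candidate under adjudication, nothing of it is asserted); AI-written, weaker than expert review.  No `sorry`;
standard axioms; DEF-FREE.  `--supports stmt-ResolutionOfSingularities-20148 --as helper`.  [folklore; K5⁸ (res-type-027 g22) re-slotted; K5⁶ (res-L1-w45b-stub-2 g16); K5′ (res-D-pv-029)]
-/

set_option linter.dupNamespace false -- mandated namespace `Summit.<Summit>.<Problem>` of this single-conjunct summit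
set_option linter.overlappingInstances false -- signatures carry `[IsDomain O] [IsDiscreteValuationRing O]`

noncomputable section

open CategoryTheory CategoryTheory.Limits AlgebraicGeometry TopologicalSpace Topology MvPolynomial
open Literature.AlgebraicGeometry.Motives (projectiveSpace)
open Literature.AlgebraicGeometry.Resolution AlgebraicGeometry.Scheme.IdealSheafData
open Summit.ResolutionOfSingularities.ResolutionOfSingularities.Theses.EquisingularLift.Split
open Summit.ResolutionOfSingularities.ResolutionOfSingularities.Cruxes.EquisingularLift.StrataSplit

namespace Summit.ResolutionOfSingularities.ResolutionOfSingularities.Cruxes.EquisingularLiftNat.Sections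
set_option maxHeartbeats 400000 in -- as ✓ K5⁸ (buildfix bf3-g30: 200k PASS at accept time); line-neutral budget line
/-- **K5⁹: the LETTERED-PREFIX T-ISO engine with NODAL and Σ-SECTION hosted rounds and hostless RAMIFIED prefix point steps** (any `n`; parametric in `Reach`, `ReachL`,
`LS`, `Open`; conditional on the eight NAMED supplier slots).  See the module docstring. [folklore; ✓ K5⁸ (res-type-027 g22) with named slots + (HR-SEC) + (P-ram)] -/
theorem target_elnat_of_letteredPrefixResolution9 (p : ℕ) : p.Prime → ∀ (k : Type) [Field k] [CharP k p] [IsAlgClosed k] (n : ℕ) (H : Scheme.{0}) (ι : H ⟶ (projectiveSpace n k).left),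
    IsClosedImmersion ι → IsIntegral H → (∀ y : (projectiveSpace n k).left, ∃ U : (projectiveSpace n k).left.affineOpens, y ∈ (U : (projectiveSpace n k).left.Opens) ∧ (ι.ker.ideal U).IsPrincipal) →
    -- the four downstairs predicates the engine is parametric in: K5′'s `Reach`, K5″'s `ReachL`/`LS`, and the certified opening `Open`
    ∀ (Reach : ∀ (F₁ F₂ : Scheme.{0}), (F₂ ⟶ F₁) → F₁ → Set F₂ → ∀ (F₉ : Scheme.{0}), (F₉ ⟶ F₂) → Set F₉ → Prop) (ReachL : ∀ (F₂ : Scheme.{0}), (F₂ ⟶ (projectiveSpace n k).left) → (projectiveSpace n k).left → Set F₂ → List (Set F₂) →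
        ∀ (F₉ : Scheme.{0}), (F₉ ⟶ F₂) → Set F₉ → Prop) (LS : ∀ (F₂ : Scheme.{0}), (F₂ ⟶ (projectiveSpace n k).left) → (projectiveSpace n k).left → List (Set F₂) → Prop)
      (Open : ∀ (F₃ : Scheme.{0}), (F₃ ⟶ (projectiveSpace n k).left) → Set F₃ → List (Set F₃) → Option (Set F₃ × Set F₃ × Set F₃) → Prop)
    -- the EIGHT upstairs suppliers, BY NAMED SLOT (`…NatPrefixSupplierDefs`): K5⁸'s six VERBATIM + HROUND-SEC + HPRAM (WIDTH TABLE W₂)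
    (HSUB : HSub1Supplier k n Reach) (HSUB₂ : HSub2Supplier k n H ι ReachL LS) (HPT : HPT6Supplier k n) (HOPEN : HOpenSupplier k n H ι Open)
    (HPAIR : HPairSupplier k n) (HROUND : HRoundKeepNSupplier k n) (HROUNDSEC : HRoundSecSupplier k n) (HPRAM : HPRamSupplier k n),
    -- the downstairs W₂ LETTERED-PREFIX resolution: Defs10's `PrefixReachKeyLetterParam9` BY NAME (clauses (0)(D)(Pc)(PL)(i)(O)(ii)(HR-KEEP-N)(HR-SEC)(P-ram), END) ∧ the end is regular
    (∃ (F' : Scheme.{0}) (ρ' : F' ⟶ (projectiveSpace n k).left) (T' : Set F'), PrefixReachKeyLetterParam9 k n H ι Reach ReachL LS Open F' ρ' T' ∧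
        Scheme.IsRegular (vanishingIdeal (⟨closure T', isClosed_closure⟩ : Closeds F')).subscheme) →
    ∃ (O : Type) (_ : CommRing O) (_ : IsDomain O) (_ : IsDiscreteValuationRing O) (_ : CharZero O) (π : O →+* k),
      Function.Surjective π ∧ (letI := MvPolynomial.gradedAlgebra (σ := Fin (n + 1)) (R := O); letI := MvPolynomial.gradedAlgebra (σ := Fin (n + 1)) (R := k); ∀ (φ : homogeneousSubmodule (Fin (n + 1)) O →+*ᵍ homogeneousSubmodule (Fin (n + 1)) k)
          (hφ' : HomogeneousIdeal.irrelevant (homogeneousSubmodule (Fin (n + 1)) k) ≤ (HomogeneousIdeal.irrelevant (homogeneousSubmodule (Fin (n + 1)) O)).map φ), (∀ s, φ s = MvPolynomial.map π s) →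
          ∀ Y : Set (Proj (homogeneousSubmodule (Fin (n + 1)) O)), Y = Set.range (ι ≫ Proj.map φ hφ' : H ⟶ Proj (homogeneousSubmodule (Fin (n + 1)) O)) → ∃ (P' : Scheme.{0})
              (σ : P' ⟶ Proj (homogeneousSubmodule (Fin (n + 1)) O)) (S' : Set P'), (∀ Q : (∀ X' : Scheme.{0}, (X' ⟶ Proj (homogeneousSubmodule (Fin (n + 1)) O)) → Set X' → Prop),
                Q (Proj (homogeneousSubmodule (Fin (n + 1)) O)) (𝟙 _) Y → (∀ (X' X'' : Scheme.{0}) (σ' : X' ⟶ Proj (homogeneousSubmodule (Fin (n + 1)) O)) (Y' : Set X') (C : X'.IdealSheafData) (τ : X'' ⟶ X'),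
                  Q X' σ' Y' → IsBlowup τ C → Scheme.IsRegular C.subscheme → Flat (C.subschemeι ≫ σ' ≫ Proj.toSpecZero (homogeneousSubmodule (Fin (n + 1)) O) ≫ Spec.map (CommRingCat.ofHom (algebraMap O (homogeneousSubmodule (Fin (n + 1)) O 0)))) →
                  σ' '' (C.support : Set X') ⊆ {x | ¬ IsGenericPoint x Y} → (C.support : Set X') ∩ (σ' ≫ Proj.toSpecZero (homogeneousSubmodule (Fin (n + 1)) O) ≫ Spec.map (CommRingCat.ofHom
                        (algebraMap O (homogeneousSubmodule (Fin (n + 1)) O 0)))) ⁻¹' {IsLocalRing.closedPoint O} ⊆ Y' → Q X'' (τ ≫ σ') (closure (τ ⁻¹' (Y' \ (C.support : Set X'))))) → Q P' σ S') ∧ Scheme.IsRegular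
                (vanishingIdeal (⟨closure S', isClosed_closure⟩ : Closeds P')).subscheme):= by
  classical
  intro hp k _ _ _ n H ι hι hH hpr Reach ReachL LS Open HSUB HSUB₂ HPT HOPEN HPAIR HROUND HROUNDSEC HPRAM hres; obtain ⟨O, i1, i2, i3, i4, i5, i6, π, hπ⟩ := stub_wittRing p hp k; refine ⟨O, i1, i2, i3, i4, π, hπ, ?_⟩
  letI := MvPolynomial.gradedAlgebra (σ := Fin (n + 1)) (R := O); letI := MvPolynomial.gradedAlgebra (σ := Fin (n + 1)) (R := k); intro φ hφ' hφ Y hYdef; subst hYdef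
  -- the fixed ambient `P = ℙⁿ_O`, `q`, and the BASE MODEL SQUARE `g : ℙⁿ_k → ℙⁿ_O` (K5″ verbatim)
  set q : Proj (homogeneousSubmodule (Fin (n + 1)) O) ⟶ Spec (.of O) := Proj.toSpecZero (homogeneousSubmodule (Fin (n + 1)) O) ≫ Spec.map (CommRingCat.ofHom (algebraMap O (homogeneousSubmodule (Fin (n + 1)) O 0))) with hq
  have hP := ProjectiveAmbientFibre.isPullback_projMap π φ hφ hπ hφ'; set g : Proj (homogeneousSubmodule (Fin (n + 1)) k) ⟶ Proj (homogeneousSubmodule (Fin (n + 1)) O) := Proj.map φ hφ' with hg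
  haveI : IsClosedImmersion (Spec.map (CommRingCat.ofHom π)) := IsClosedImmersion.spec_of_surjective _ hπ; haveI : IsClosedImmersion g := MorphismProperty.IsStableUnderBaseChange.of_isPullback hP.flip inferInstance
  have hsq₀ : IsPullback g (Proj.toSpecZero (homogeneousSubmodule (Fin (n + 1)) k) ≫ Spec.map (CommRingCat.ofHom (algebraMap k (homogeneousSubmodule (Fin (n + 1)) k 0)))) (𝟙 _ ≫ q) (Spec.map (CommRingCat.ofHom π)) := by
    rw [Category.id_comp]; exact hP
  have hrangeg : Set.range g = q ⁻¹' {IsLocalRing.closedPoint O} := by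
    rw [range_eq_preimage_of_isPullback hP, range_specMap_of_surjective_of_field π hπ]
  -- the closed immersion `f = ι ≫ g : H ⟶ ℙⁿ_O` and its (closed) range `Y`
  haveI := hH; let ι' : H ⟶ Proj (homogeneousSubmodule (Fin (n + 1)) k) := ι; haveI : IsClosedImmersion ι' := hι; let f : H ⟶ Proj (homogeneousSubmodule (Fin (n + 1)) O) := ι' ≫ g
  let Yc : Closeds (Proj (homogeneousSubmodule (Fin (n + 1)) O)) := ⟨Set.range f, f.isClosedEmbedding.isClosed_range⟩; have hYc : (Yc : Set (Proj (homogeneousSubmodule (Fin (n + 1)) O))) = Set.range (ι ≫ Proj.map φ hφ') := rfl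
  have hsub : (Yc : Set (Proj (homogeneousSubmodule (Fin (n + 1)) O))) ⊆ q ⁻¹' {IsLocalRing.closedPoint O} := by
    rintro _ ⟨x, rfl⟩; rw [← hrangeg]; exact ⟨ι' x, (Scheme.Hom.comp_apply _ _ x).symm⟩
  obtain ⟨hsm, hprop⟩ := stub_projectiveAmbientSmoothProper O n; haveI : IsProper q := hprop
  -- `Y` is irreducible (image of the integral `H`)
  have hYirr : IsIrreducible (Yc : Set (Proj (homogeneousSubmodule (Fin (n + 1)) O))) := by
    have h := (IrreducibleSpace.isIrreducible_univ H).image f f.continuous.continuousOn; rwa [Set.image_univ] at h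
  obtain ⟨ξ, hξ⟩ : ∃ ξ : Proj (homogeneousSubmodule (Fin (n + 1)) O), IsGenericPoint ξ (Yc : Set _) := QuasiSober.sober hYirr Yc.isClosed
  -- EL♮'s HORIZONTAL induction principle as a stage predicate over the fixed base
  obtain ⟨Ch, hCh⟩ : ∃ Ch : ∀ X' : Scheme.{0}, (X' ⟶ Proj (homogeneousSubmodule (Fin (n + 1)) O)) → Set X' → Prop, ∀ (X₁ : Scheme.{0}) (σ₁ : X₁ ⟶ Proj (homogeneousSubmodule (Fin (n + 1)) O)) (S₁ : Set X₁), Ch X₁ σ₁ S₁ ↔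
      ∀ Q : (∀ X' : Scheme.{0}, (X' ⟶ Proj (homogeneousSubmodule (Fin (n + 1)) O)) → Set X' → Prop), Q (Proj (homogeneousSubmodule (Fin (n + 1)) O)) (𝟙 _) (Yc : Set (Proj (homogeneousSubmodule (Fin (n + 1)) O))) →
        (∀ (X' X'' : Scheme.{0}) (σ' : X' ⟶ Proj (homogeneousSubmodule (Fin (n + 1)) O)) (Y' : Set X') (C : X'.IdealSheafData) (τ : X'' ⟶ X'), Q X' σ' Y' → IsBlowup τ C → Scheme.IsRegular C.subscheme → Flat (C.subschemeι ≫ σ' ≫ q) →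
          σ' '' (C.support : Set X') ⊆ {x | ¬ IsGenericPoint x (Yc : Set (Proj (homogeneousSubmodule (Fin (n + 1)) O)))} → (C.support : Set X') ∩ (σ' ≫ q) ⁻¹' {IsLocalRing.closedPoint O} ⊆ Y' →
          Q X'' (τ ≫ σ') (closure (τ ⁻¹' (Y' \ (C.support : Set X'))))) → Q X₁ σ₁ S₁ := ⟨_, fun _ _ _ => Iff.rfl⟩; have hChain : ∀ (X' : Scheme.{0}) (σ : X' ⟶ Proj (homogeneousSubmodule (Fin (n + 1)) O)) (S : Set X'),
      Ch X' σ S → Chain (Proj (homogeneousSubmodule (Fin (n + 1)) O)) (Yc : Set (Proj (homogeneousSubmodule (Fin (n + 1)) O))) X' σ S := fun X' σ S h Q h0 hs => (hCh X' σ S).mp h Q h0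
      (fun X₁ X₂ σ' Y' C τ hQ hb hr _ hg' _ => hs X₁ X₂ σ' Y' C τ hQ hb hr hg'); have hStep : ∀ (X' X'' : Scheme.{0}) (σ' : X' ⟶ Proj (homogeneousSubmodule (Fin (n + 1)) O)) (S' : Set X') (C : X'.IdealSheafData) (τ : X'' ⟶ X'),
      Ch X' σ' S' → IsBlowup τ C → Scheme.IsRegular C.subscheme → Flat (C.subschemeι ≫ σ' ≫ q) → σ' '' (C.support : Set X') ⊆ {x | ¬ IsGenericPoint x (Yc : Set (Proj (homogeneousSubmodule (Fin (n + 1)) O)))} →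
      (C.support : Set X') ∩ (σ' ≫ q) ⁻¹' {IsLocalRing.closedPoint O} ⊆ S' → Ch X'' (τ ≫ σ') (closure (τ ⁻¹' (S' \ (C.support : Set X')))) := fun X' X'' σ' S' C τ h hb hr hfl hg' hE => (hCh _ _ _).mpr fun Q h0 hs =>
      hs X' X'' σ' S' C τ ((hCh X' σ' S').mp h Q h0 hs) hb hr hfl hg' hE; have hCh₀ : Ch (Proj (homogeneousSubmodule (Fin (n + 1)) O)) (𝟙 _) (Yc : Set (Proj (homogeneousSubmodule (Fin (n + 1)) O))) := (hCh _ _ _).mpr fun Q h0 _ => h0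
  have hPnoeth : IsLocallyNoetherian (Proj (homogeneousSubmodule (Fin (n + 1)) O)) := LocallyOfFiniteType.isLocallyNoetherian q
  have hPreg : Scheme.IsRegular (Proj (homogeneousSubmodule (Fin (n + 1)) O)) := fun y => (stub_goodAtOfSmooth O _ q hsm y).1; haveI hPint : IsIntegral (Proj (homogeneousSubmodule (Fin (n + 1)) O)) :=
    Proj.isIntegral _ (irrelevant_homogeneousSubmodule_ne_bot n O); haveI hsrd : SmoothOfRelativeDimension n q := smoothOfRelativeDimension_toSpecZero_specMap n O
  -- the INITIAL stage `(ℙⁿ_O, 𝟙, Y)` with model `ℙⁿ_k` (hoisted: used by the base case, (PL) and (O))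
  haveI : Nonempty H := inferInstance; haveI : Nonempty (Proj (homogeneousSubmodule (Fin (n + 1)) O)) := ⟨f (Classical.arbitrary H)⟩; haveI : Smooth q := hsm; haveI : IsDominant q := isDominant_of_smooth_of_nonempty q
  have hdom₀ : IsDominant (𝟙 (Proj (homogeneousSubmodule (Fin (n + 1)) O)) ≫ q) := by
    rw [Category.id_comp]; infer_instance
  have hirrι : IsIrreducible (Set.range ι') := by
    have h := (IrreducibleSpace.isIrreducible_univ H).image ι' ι'.continuous.continuousOn; rwa [Set.image_univ] at h
  have hT₁cl₀ : IsClosed (Set.range ι') := ι'.isClosedEmbedding.isClosed_range; haveI hF₁k : IsIntegral (Proj (homogeneousSubmodule (Fin (n + 1)) k)) := isIntegral_proj_homogeneousSubmodule n k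
  have hTS₀ : g '' Set.range ι' = (Yc : Set (Proj (homogeneousSubmodule (Fin (n + 1)) O))) := by
    change g '' Set.range ι' = Set.range f; rw [← Set.range_comp]; rfl
  -- THE INDUCTION PREDICATE: K5′'s model square ∧ every listed letter has a `TCPlus.LetterDatum` ∧ the TAG BLOCK (its own three models + the incidence)
  let QD : ∀ F₁ : Scheme.{0}, (F₁ ⟶ (projectiveSpace n k).left) → Set F₁ → List (Set F₁) → Option (Set F₁ × Set F₁ × Set F₁) → Prop := fun F₁ _ T₁ Ls Kp => IsClosed T₁ ∧ IsIrreducible T₁ ∧ IsIntegral F₁ ∧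
      ∃ (X' : Scheme.{0}) (σ' : X' ⟶ Proj (homogeneousSubmodule (Fin (n + 1)) O)) (S' : Set X') (j : F₁ ⟶ X') (t : F₁ ⟶ Spec (.of k)), Ch X' σ' S' ∧ IsIntegral X' ∧ IsLocallyNoetherian X' ∧ Scheme.IsRegular X' ∧ IsDominant (σ' ≫ q) ∧
        IsPullback j t (σ' ≫ q) (Spec.map (CommRingCat.ofHom π)) ∧ j '' T₁ = S' ∧ (∀ L ∈ Ls, TCPlus.LetterDatum O (Proj (homogeneousSubmodule (Fin (n + 1)) O)) q (Yc : Set (Proj (homogeneousSubmodule (Fin (n + 1)) O))) F₁ X' σ' j L) ∧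
        (∀ K A C : Set F₁, Kp = some (K, A, C) → ∃ (𝓚 𝓐 𝓒 : X'.IdealSheafData),
          (𝓚.comap j = vanishingIdeal (⟨closure K, isClosed_closure⟩ : Closeds F₁) ∧ (∀ z : X', (stalkIdeal 𝓚 z).IsPrincipal) ∧ Scheme.IsRegular 𝓚.subscheme ∧ σ' '' (𝓚.support : Set X') ⊆ {y : ↥(Proj (homogeneousSubmodule (Fin (n + 1)) O)) | ¬ IsGenericPoint y (Yc : Set (Proj (homogeneousSubmodule (Fin (n + 1)) O)))} ∧ Flat (𝓚.subschemeι ≫ σ' ≫ q)) ∧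
          (𝓐.comap j = vanishingIdeal (⟨closure A, isClosed_closure⟩ : Closeds F₁) ∧ (∀ z : X', (stalkIdeal 𝓐 z).IsPrincipal) ∧ Scheme.IsRegular 𝓐.subscheme ∧ σ' '' (𝓐.support : Set X') ⊆ {y : ↥(Proj (homogeneousSubmodule (Fin (n + 1)) O)) | ¬ IsGenericPoint y (Yc : Set (Proj (homogeneousSubmodule (Fin (n + 1)) O)))} ∧ Flat (𝓐.subschemeι ≫ σ' ≫ q)) ∧
          (𝓒.comap j = vanishingIdeal (⟨closure C, isClosed_closure⟩ : Closeds F₁) ∧ (∀ z : X', (stalkIdeal 𝓒 z).IsPrincipal) ∧ Scheme.IsRegular 𝓒.subscheme ∧ σ' '' (𝓒.support : Set X') ⊆ {y : ↥(Proj (homogeneousSubmodule (Fin (n + 1)) O)) | ¬ IsGenericPoint y (Yc : Set (Proj (homogeneousSubmodule (Fin (n + 1)) O)))} ∧ Flat (𝓒.subschemeι ≫ σ' ≫ q)) ∧ 𝓚 ≤ 𝓐 ⊔ 𝓒)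
  -- THE INDUCTION along the downstairs closure
  obtain ⟨F', ρ', T', hclos, hregD⟩ := hres; have hQD : ∃ (Ls : List (Set F')) (Kp : Option (Set F' × Set F' × Set F')), QD F' ρ' T' Ls Kp := by
    refine hclos QD ?_ ?_ ?_ ?_ ?_ ?_ ?_ ?_ ?_ ?_
    · -- (0) BASE: `(ℙⁿ_k, 𝟙, range ι, [], none)` IS the special fibre of `(ℙⁿ_O, 𝟙, Y)`; no letters, no tag
      refine ⟨hT₁cl₀, hirrι, hF₁k, _, 𝟙 _, (Yc : Set (Proj (homogeneousSubmodule (Fin (n + 1)) O))), g, _, hCh₀, hPint, hPnoeth, hPreg, hdom₀, hsq₀, hTS₀, fun L hL => by simp at hL, fun K A C h => by simp at h⟩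
    · -- (D) DROP
      intro F₁ ρ T₁ Ls Ls' Kp Kp' hQ₁ hsubL hKp'; obtain ⟨hT₁cl, hT₁irr, hF₁, X', σ', S', j, t, hChX, hX'int, hX'noeth, hX'reg, hdom, hsq, hTS, hLs, hTag⟩ := hQ₁
      refine ⟨hT₁cl, hT₁irr, hF₁, X', σ', S', j, t, hChX, hX'int, hX'noeth, hX'reg, hdom, hsq, hTS, fun L hL => hLs L (hsubL L hL), ?_⟩; rcases hKp' with rfl | rfl
      · exact hTag
      · intro K A C h; simp at h
    · -- (Pc) K5′ POINT STEPS + `Reach`-moves, letters and tag dropped (K5″'s STEPS case verbatim)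
      intro F₁ F₂ ρ T₁ Ls Kp x υ hx hQ₁ hxreg hFreg hυ; obtain ⟨hT₁cl, hT₁irr, hF₁, X', σ', S', j, t, hChX, hX'int, hX'noeth, hX'reg, hdom, hsq, hTS, -, -⟩ := hQ₁; haveI := hF₁; haveI := hX'int; haveI := hX'noeth
      obtain ⟨hF₂, hT₂irr, U, s, X'', τ, j₂, t₂, hproper, hU, hs, hsU, hss₀, hoffs, hτ, hcomm, hE, hCh'', hint'', hnoeth'',
        hreg'', hdom'', hsq₂⟩ := modelPointStep_chain' O k π hπ _ q (Yc : Set (Proj (homogeneousSubmodule (Fin (n + 1)) O))) hsub hYirr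
          Yc.isClosed hPnoeth hPreg Ch hChain hStep X' σ' S' hChX hX'reg hdom F₁ j t hsq T₁ hT₁cl hT₁irr hTS x hx hxreg hFreg F₂ υ hυ; haveI := hF₂; haveI := hint''; haveI := hnoeth''
      haveI hj₂ci : IsClosedImmersion j₂ := MorphismProperty.IsStableUnderBaseChange.of_isPullback hsq₂.flip inferInstance; refine ⟨⟨isClosed_closure, hT₂irr, hF₂, X'', τ ≫ σ', _, j₂, t₂, hCh'', hint'', hnoeth'', hreg'', hdom'', hsq₂, rfl,
        fun L hL => by simp at hL, fun K A C h => by simp at h⟩, ?_⟩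
      -- the sub-chain: handed to the supplier HSUB₁
      intro F₉ β T₉ hReach; haveI hjci : IsClosedImmersion j := MorphismProperty.IsStableUnderBaseChange.of_isPullback hsq.flip inferInstance; have hwcl : IsClosed ({s (IsLocalRing.closedPoint O)} : Set X') := by
        rw [hss₀]; have h := hjci.isClosedEmbedding.isClosedMap _ hx; rwa [Set.image_singleton] at h
      have hws₀ : (σ' ≫ q).base (s (IsLocalRing.closedPoint O)) = IsLocalRing.closedPoint O := by
        change (s ≫ σ' ≫ q) (IsLocalRing.closedPoint O) = _; rw [hs]; rfl
      have hdim : ringKrullDim (X'.presheaf.stalk (s (IsLocalRing.closedPoint O))) = ((n + 1 : ℕ) : WithBot ℕ∞) := ringKrullDim_stalk_eq_succ_of_chain q n hξ (hChain _ _ _ hChX) hwcl hws₀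
      obtain ⟨X₉, σ₉, S₉, j₉, t₉, hCh₉, hint₉, hnoeth₉, hreg₉, hdom₉, hsq₉, hsets₉, hT₉cl, hT₉irr, hF₉⟩ := HSUB O π hπ _ q (Yc : Set (Proj (homogeneousSubmodule (Fin (n + 1)) O))) Ch hStep hChain hsub hYirr Yc.isClosed
          hPint hPnoeth hPreg hprop hsrd X' σ' S' hChX hX'int hX'noeth hX'reg hdom F₁ hF₁ j t hsq T₁ hT₁cl hT₁irr hTS _ hx U hU s hs hsU hss₀ hdim hFreg hoffs X'' τ hτ hint'' hnoeth'' hreg'' hdom'' F₂ hF₂ υ hυ j₂ t₂ hsq₂ hcomm hE hT₂irr hCh''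
          F₉ β T₉ hReach; exact ⟨hT₉cl, hT₉irr, hF₉, X₉, σ₉, S₉, j₉, t₉, hCh₉, hint₉, hnoeth₉, hreg₉, hdom₉, hsq₉, hsets₉, fun L hL => by simp at hL, fun K A C h => by simp at h⟩
    · -- (PL) A⁗: LETTERED TOWERS AT THE INITIAL STAGE — the point step is run at the base stage `(ℙⁿ_O, 𝟙, Y)`, then HSUB₂ (K5″ verbatim)
      intro F₂ x₀ υ hx₀ Ls₂ hxreg hFreg hυ hLs F₉ β T₉ hReachL; obtain ⟨hF₂, hT₂irr, U, s, X'', τ, j₂, t₂, hproper, hU, hs, hsU, hss₀, hoffs, hτ, hcomm, hE, hCh'', hint'', hnoeth'',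
        hreg'', hdom'', hsq₂⟩ := modelPointStep_chain' O k π hπ _ q (Yc : Set (Proj (homogeneousSubmodule (Fin (n + 1)) O))) hsub hYirr
          Yc.isClosed hPnoeth hPreg Ch hChain hStep _ (𝟙 _) _ hCh₀ hPreg hdom₀ _ g _ hsq₀ (Set.range ι') hT₁cl₀ hirrι hTS₀ x₀ hx₀ hxreg hFreg F₂ υ hυ; haveI := hF₂; haveI := hint''; haveI := hnoeth''
      have hwcl : IsClosed ({s (IsLocalRing.closedPoint O)} : Set (Proj (homogeneousSubmodule (Fin (n + 1)) O))) := by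
        rw [hss₀]; have h := (inferInstance : IsClosedImmersion g).isClosedEmbedding.isClosedMap ({((Scheme.IdealSheafData.vanishingIdeal (⟨closure (Set.range ι), isClosed_closure⟩ :
              Closeds (Proj (homogeneousSubmodule (Fin (n + 1)) k)))).subschemeι x₀ : Proj (homogeneousSubmodule (Fin (n + 1)) k))} : Set (Proj (homogeneousSubmodule (Fin (n + 1)) k))) hx₀; rwa [Set.image_singleton] at h
      have hws₀ : (𝟙 (Proj (homogeneousSubmodule (Fin (n + 1)) O)) ≫ q).base (s (IsLocalRing.closedPoint O)) = IsLocalRing.closedPoint O := by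
        change (s ≫ 𝟙 _ ≫ q) (IsLocalRing.closedPoint O) = _; rw [hs]; rfl
      have hdim : ringKrullDim ((Proj (homogeneousSubmodule (Fin (n + 1)) O)).presheaf.stalk (s (IsLocalRing.closedPoint O))) = ((n + 1 : ℕ) : WithBot ℕ∞) := ringKrullDim_stalk_eq_succ_of_chain q n hξ (hChain _ _ _ hCh₀) hwcl hws₀
      obtain ⟨X₉, σ₉, S₉, j₉, t₉, hCh₉, hint₉, hnoeth₉, hreg₉, hdom₉, hsq₉, hsets₉, hT₉cl, hT₉irr, hF₉⟩ := HSUB₂ O π hπ φ hφ' hφ Ch hStep hChain hsub hYirr Yc.isClosed hPint hPnoeth hPreg hprop hsrd hCh₀ hdom₀ hF₁k _ hsq₀ hT₁cl₀ hirrι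
          hTS₀ _ hx₀ U hU s hs hsU hss₀ hdim hFreg hoffs X'' τ hτ hint'' hnoeth'' hreg'' hdom'' F₂ hF₂ υ hυ j₂ t₂ hsq₂ hcomm hE hT₂irr hCh'' Ls₂ hLs F₉ β T₉ hReachL
      exact ⟨hT₉cl, hT₉irr, hF₉, X₉, σ₉, S₉, j₉, t₉, hCh₉, hint₉, hnoeth₉, hreg₉, hdom₉, hsq₉, hsets₉, fun L hL => by simp at hL, fun K A C h => by simp at h⟩
    · -- (i) LETTERED POINT STEPS (HPT⁶)
      intro F₁ F₂ ρ T₁ Ls Kp Lt x υ hx hQ₁ hxreg hFreg hLt hLt' hKaway hυ Ls' hLs'; obtain ⟨hT₁cl, hT₁irr, hF₁, X', σ', S', j, t, hChX, hX'int, hX'noeth, hX'reg, hdom, hsq, hTS, hLs, hTag⟩ := hQ₁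
      obtain ⟨X₉, σ₉, S₉, j₉, t₉, hCh₉, hint₉, hnoeth₉, hreg₉, hdom₉, hsq₉, hsets₉, hT₉cl, hT₉irr, hF₂, hLs₉, hE₉, hTag₉⟩ := HPT O π hπ _ q (Yc : Set (Proj (homogeneousSubmodule (Fin (n + 1)) O))) Ch hStep hChain hsub hYirr Yc.isClosed hPint hPnoeth
          hPreg hprop hsrd X' σ' S' hChX hX'int hX'noeth hX'reg hdom F₁ hF₁ j t hsq T₁ hT₁cl hT₁irr hTS Ls Kp hLs hTag Lt x hx hxreg hFreg hLt hLt' hKaway F₂ υ hυ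
      refine ⟨hT₉cl, hT₉irr, hF₂, X₉, σ₉, S₉, j₉, t₉, hCh₉, hint₉, hnoeth₉, hreg₉, hdom₉, hsq₉, hsets₉, ?_, ?_⟩
      · rcases hLs' with rfl | rfl
        · intro L hL; obtain ⟨L₀, hL₀, rfl⟩ := List.mem_map.mp hL; exact hLs₉ L₀ hL₀
        · intro L hL; rcases List.mem_append.mp hL with hL | hL
          · obtain ⟨L₀, hL₀, rfl⟩ := List.mem_map.mp hL; exact hLs₉ L₀ hL₀
          · rw [List.mem_singleton] at hL; subst hL; exact hE₉
      · intro K A C hKAC; cases Kp with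
        | none => simp at hKAC
        | some t =>
          obtain ⟨K₀, A₀, C₀⟩ := t; simp only [Option.map_some, Option.some.injEq, Prod.mk.injEq] at hKAC; obtain ⟨rfl, rfl, rfl⟩ := hKAC; exact hTag₉ K₀ A₀ C₀ rfl
    · -- (O) CERTIFIED OPENINGS (HOPEN), at the initial stage
      intro F₃ ρ₃ T₃ Ls₃ Kp₃ hOpen; obtain ⟨X₉, σ₉, S₉, j₉, t₉, hCh₉, hint₉, hnoeth₉, hreg₉, hdom₉, hsq₉, hsets₉, hT₉cl, hT₉irr, hF₃, hLs₉, hTag₉⟩ :=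
        HOPEN O π hπ φ hφ' hφ Ch hStep hChain hsub hYirr Yc.isClosed hPint hPnoeth hPreg hprop hsrd hCh₀ hdom₀ hF₁k _ hsq₀ hT₁cl₀ hirrι hTS₀ F₃ ρ₃ T₃ Ls₃ Kp₃ hOpen
      exact ⟨hT₉cl, hT₉irr, hF₃, X₉, σ₉, S₉, j₉, t₉, hCh₉, hint₉, hnoeth₉, hreg₉, hdom₉, hsq₉, hsets₉, hLs₉, hTag₉⟩
    · -- (ii) PAIR ROUNDS (HPAIR)
      intro F₁ F₃ ρ T₁ Ls Kp A B Z hZ υ' hQ₁ hA hB hAB hcross hZT hTZ hZreg hZdim hFZreg hHost hOthers hυ' Ls' hLs'; obtain ⟨hT₁cl, hT₁irr, hF₁, X', σ', S', j, t, hChX, hX'int, hX'noeth, hX'reg, hdom, hsq, hTS, hLs, hTag⟩ := hQ₁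
      obtain ⟨X₉, σ₉, S₉, j₉, t₉, hCh₉, hint₉, hnoeth₉, hreg₉, hdom₉, hsq₉, hsets₉, hT₉cl, hT₉irr, hF₃, hLs₉, hE₉⟩ := HPAIR O π hπ _ q (Yc : Set (Proj (homogeneousSubmodule (Fin (n + 1)) O))) Ch hStep hChain hsub hYirr Yc.isClosed hPint hPnoeth
          hPreg hprop hsrd X' σ' S' hChX hX'int hX'noeth hX'reg hdom F₁ hF₁ j t hsq T₁ hT₁cl hT₁irr hTS Ls Kp hLs hTag A B Z hZ hA hB hAB hcross hZT hTZ hZreg hZdim hFZreg hHost hOthers F₃ υ' hυ'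
      refine ⟨hT₉cl, hT₉irr, hF₃, X₉, σ₉, S₉, j₉, t₉, hCh₉, hint₉, hnoeth₉, hreg₉, hdom₉, hsq₉, hsets₉, ?_, fun K A C h => by simp at h⟩; rcases hLs' with rfl | rfl
      · intro L hL; obtain ⟨L₀, hL₀, rfl⟩ := List.mem_map.mp hL; exact hLs₉ L₀ hL₀
      · intro L hL; rcases List.mem_append.mp hL with hL | hL
        · obtain ⟨L₀, hL₀, rfl⟩ := List.mem_map.mp hL; exact hLs₉ L₀ hL₀
        · rw [List.mem_singleton] at hL; subst hL; exact hE₉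
    · -- (HR-KEEP-N) NODAL HOSTED ROUNDS THAT KEEP THEIR MEMBERS (HROUND-KEEP-N; support debt S-D8-LIFT): every listed letter `↦ St`, birth of `υ'⁻¹ Z`, tag dropped
      intro F₁ F₃ ρ T₁ Ls Kp E₁ Z hZ υ' hQ₁ hE₁ hZE hZT hTZ hZfin hEreg hunobs hN4 hZdim hOthers hυ'; obtain ⟨hT₁cl, hT₁irr, hF₁, X', σ', S', j, t, hChX, hX'int, hX'noeth, hX'reg, hdom, hsq, hTS, hLs, -⟩ := hQ₁
      obtain ⟨X₉, σ₉, S₉, j₉, t₉, hCh₉, hint₉, hnoeth₉, hreg₉, hdom₉, hsq₉, hsets₉, hT₉cl, hT₉irr, hF₃, hLs₉, hE₉⟩ := HROUND O π hπ _ q (Yc : Set (Proj (homogeneousSubmodule (Fin (n + 1)) O))) Ch hStep hChain hsub hYirr Yc.isClosed hPint hPnoeth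
          hPreg hprop hsrd X' σ' S' hChX hX'int hX'noeth hX'reg hdom F₁ hF₁ j t hsq T₁ hT₁cl hT₁irr hTS Ls hLs E₁ Z hZ F₃ υ' hE₁ hZE hZT hTZ hZfin hEreg hunobs hN4 hZdim hOthers hυ'
      refine ⟨hT₉cl, hT₉irr, hF₃, X₉, σ₉, S₉, j₉, t₉, hCh₉, hint₉, hnoeth₉, hreg₉, hdom₉, hsq₉, hsets₉, ?_, fun K A C h => by simp at h⟩; intro L hL; rcases List.mem_append.mp hL with hL | hL
      · obtain ⟨L₀, hL₀, rfl⟩ := List.mem_map.mp hL; exact hLs₉ L₀ hL₀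
      · rw [List.mem_singleton] at hL; subst hL; exact hE₉
    · -- (HR-SEC) Σ-SECTION HOSTED ROUNDS THAT KEEP THEIR MEMBERS (HROUND-SEC; WIDTH TABLE W₂): every listed letter `↦ St`, birth of `υ'⁻¹ Z`, tag dropped — the (HR-KEEP-N) case verbatim over the new slot
      intro F₁ F₃ ρ T₁ Ls Kp E₁ Z hZ υ' hQ₁ hE₁ hZE hZT hTZ hZfin hL2 hunobs hZdim hOthers hυ'; obtain ⟨hT₁cl, hT₁irr, hF₁, X', σ', S', j, t, hChX, hX'int, hX'noeth, hX'reg, hdom, hsq, hTS, hLs, -⟩ := hQ₁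
      obtain ⟨X₉, σ₉, S₉, j₉, t₉, hCh₉, hint₉, hnoeth₉, hreg₉, hdom₉, hsq₉, hsets₉, hT₉cl, hT₉irr, hF₃, hLs₉, hE₉⟩ := HROUNDSEC O π hπ _ q (Yc : Set (Proj (homogeneousSubmodule (Fin (n + 1)) O))) Ch hStep hChain hsub hYirr Yc.isClosed hPint hPnoeth
          hPreg hprop hsrd X' σ' S' hChX hX'int hX'noeth hX'reg hdom F₁ hF₁ j t hsq T₁ hT₁cl hT₁irr hTS Ls hLs E₁ Z hZ F₃ υ' hE₁ hZE hZT hTZ hZfin hL2 hunobs hZdim hOthers hυ'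
      refine ⟨hT₉cl, hT₉irr, hF₃, X₉, σ₉, S₉, j₉, t₉, hCh₉, hint₉, hnoeth₉, hreg₉, hdom₉, hsq₉, hsets₉, ?_, fun K A C h => by simp at h⟩; intro L hL; rcases List.mem_append.mp hL with hL | hL
      · obtain ⟨L₀, hL₀, rfl⟩ := List.mem_map.mp hL; exact hLs₉ L₀ hL₀
      · rw [List.mem_singleton] at hL; subst hL; exact hE₉
    · -- (P-ram) HOSTLESS RAMIFIED POINT STEPS (HPRAM; WIDTH TABLE W₂): the supplier returns the new model square for `(F₂, St T₁)`; letters `[]`, tag `none`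
      intro F₁ F₂ ρ T₁ Ls Kp y J υ₂ hQ₁ hTreg hFreg hJsupp hJgen hυ₂; obtain ⟨hT₁cl, hT₁irr, hF₁, X', σ', S', j, t, hChX, hX'int, hX'noeth, hX'reg, hdom, hsq, hTS, -, -⟩ := hQ₁
      obtain ⟨X₉, σ₉, S₉, j₉, t₉, hCh₉, hint₉, hnoeth₉, hreg₉, hdom₉, hsq₉, hsets₉, hT₉cl, hT₉irr, hF₂⟩ := HPRAM O π hπ _ q (Yc : Set (Proj (homogeneousSubmodule (Fin (n + 1)) O))) Ch hStep hChain hsub hYirr Yc.isClosed hPint hPnoeth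
          hPreg hprop hsrd X' σ' S' hChX hX'int hX'noeth hX'reg hdom F₁ hF₁ j t hsq T₁ hT₁cl hT₁irr hTS y J F₂ υ₂ hTreg hFreg hJsupp hJgen hυ₂
      exact ⟨hT₉cl, hT₉irr, hF₂, X₉, σ₉, S₉, j₉, t₉, hCh₉, hint₉, hnoeth₉, hreg₉, hdom₉, hsq₉, hsets₉, fun L hL => by simp at hL, fun K A C h => by simp at h⟩
  -- THE END: transport the downstairs regularity through the model (K5″ verbatim)
  obtain ⟨Ls', Kp', hT'cl, -, -, X₁, σ₁, S₁, j₁, t₁, hCh₁, -, -, -, -, hsq₁, hTS₁, -, -⟩ := hQD; haveI hj₁ci : IsClosedImmersion j₁ := MorphismProperty.IsStableUnderBaseChange.of_isPullback hsq₁.flip inferInstance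
  have hT'img : IsClosed (j₁ '' T') := hj₁ci.isClosedEmbedding.isClosedMap _ hT'cl; have hZ1 : (⟨closure T', isClosed_closure⟩ : Closeds F') = ⟨T', hT'cl⟩ := Closeds.ext hT'cl.closure_eq
  have hZ2 : (⟨closure S₁, isClosed_closure⟩ : Closeds X₁) = ⟨j₁ '' T', hT'img⟩ := Closeds.ext (by change closure S₁ = j₁ '' T'; rw [← hTS₁]; exact hT'img.closure_eq); rw [hZ1] at hregD; refine ⟨X₁, σ₁, S₁, (hCh X₁ σ₁ S₁).mp hCh₁, ?_⟩; rw [hZ2]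
  exact (isRegular_subscheme_vanishingIdeal_image_iff j₁ ⟨T', hT'cl⟩ hT'img).mpr hregD

end Summit.ResolutionOfSingularities.ResolutionOfSingularities.Cruxes.EquisingularLiftNat.Sections
end
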